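import Mathlib
import Summits.PneNP.PneNP.Theorems.SfmBlSpotAccounting
import Summits.PneNP.PneNP.Theorems.SfmBlSpotBudget
import Summits.PneNP.PneNP.Theorems.SfmBlConnectedPairsRect
import Summits.PneNP.PneNP.Theorems.SfmBlNumerics

/-!
# The spot package: Prop. 9 + Lemma 10 + pair counting + the `ê`-numerics for ONE spot — line «sfm-bl»

FRONTIER F-N1c; nothing here bears on P vs NP.

For one spot in the leg model (legs `e : E` with `src e ∈ V₁`, `dst e ∈ V₂`, outputs `out e`; `≤ 3` legs per
output; leg-degrees `≤ Lₙ` (`Lₙ ≥ 2`); dense at extraction: `#E > 60γ′·√(|V₁||V₂|)`; signed matrices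
`M T i k = Σ_{e : i → k} χ(T (out e))`; `γ′² ≥ 144·Lₙ·ln Lₙ`) there is a nonnegative function
`ê : (Fin m → Bool) → ℝ` with

* `σᵀ (M T) φ < #E/30 + ê(T)` for every signing `T` and all `±1` vectors (Prop. 9
  `spot_cut_lt_of_dense` with `B = ⋃ bad` + `good_of_disjoint_bad` + `card_meeting_bad_le_hatE`, the bad family being the `G_S`-connected pairs of discrepancy
  `> γ′√(|W₁||W₂|)`, `G_S = bipGraph` of the spot's legs), and
* `Σ_T ê(T) ≤ 2^m · 4·(|V₁|+|V₂|)·Lₙ⁻¹⁰` (Lemma 10 `sum_hatE_le` + `card_meeting_le` + layer cake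
  `sum_le_sum_by_size` with prover-1's anchored count `card_connectedPairs_through_le` + p3's
  `hatWeight_range_le`).

This is exactly the per-spot input (`hspot`, `hatS`, and the `Q₀`-bookkeeping) of `SfmBl.cutCertified_of_greedy`
(this file deliberately does not import `SfmBlAssembly`).
All auxiliary objects (the spot graph, `bad`, `𝒲`) live inside the proof; the statement is definition-free.
-/

namespace Summit.PneNP.PneNP.Theorems.SfmBl

open Matrix Finset BigOperators
open Summit.PneNP.PneNP.Theorems.CandCutNorm

/-- In a connected induced subgraph with two distinct vertices, every vertex has a neighbour inside. -/
theorem exists_adj_of_connected_induce {V : Type*} (G : SimpleGraph V) (X : Set V)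
    (hc : (G.induce X).Connected) {x y : V} (hx : x ∈ X) (hy : y ∈ X) (hxy : x ≠ y) :
    ∃ z, z ∈ X ∧ G.Adj x z := by
  obtain ⟨w⟩ := hc.preconnected ⟨x, hx⟩ ⟨y, hy⟩
  have key : ∀ (p q : X) (w' : (G.induce X).Walk p q), p.1 ≠ q.1 → ∃ z, z ∈ X ∧ G.Adj p.1 z := by
    intro p q w' hpq
    cases w' with
    | nil => exact absurd rfl hpq
    | @cons _ b _ hadj _ => exact ⟨b.1, b.2, SimpleGraph.induce_adj.1 hadj⟩
  exact key _ _ w hxy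

/-- The `bipGraph` of a leg relation has degrees bounded by the leg-degrees. -/
theorem degree_bipGraph_le {α β E : Type} [Fintype α] [Fintype β] [DecidableEq α] [DecidableEq β]
    [Fintype E] (src : E → α) (dst : E → β) {Lₙ : ℕ}
    (hdeg₁ : ∀ i, (Finset.univ.filter fun e => src e = i).card ≤ Lₙ)
    (hdeg₂ : ∀ k, (Finset.univ.filter fun e => dst e = k).card ≤ Lₙ)
    [DecidableRel (bipGraph (fun i k => ∃ e, src e = i ∧ dst e = k)).Adj] (x : α ⊕ β) :
    (bipGraph (fun i k => ∃ e, src e = i ∧ dst e = k)).degree x ≤ Lₙ := by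
  classical
  rw [← SimpleGraph.card_neighborFinset_eq_degree]
  cases x with
  | inl i =>
    have hsub : (bipGraph (fun i k => ∃ e, src e = i ∧ dst e = k)).neighborFinset (Sum.inl i)
        ⊆ (Finset.univ.filter fun e => src e = i).image (fun e => Sum.inr (dst e)) := by
      intro y hy
      rw [SimpleGraph.mem_neighborFinset] at hy
      cases y with
      | inl i' => exact absurd hy (bipGraph_not_adj_inl_inl _ _ _)
      | inr k =>
        obtain ⟨e, he1, he2⟩ := (bipGraph_adj_inl_inr _ _ _).1 hy
        exact Finset.mem_image.2 ⟨e, by simp [he1], by rw [he2]⟩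
    exact (Finset.card_le_card hsub).trans (Finset.card_image_le.trans (hdeg₁ i))
  | inr k =>
    have hsub : (bipGraph (fun i k => ∃ e, src e = i ∧ dst e = k)).neighborFinset (Sum.inr k)
        ⊆ (Finset.univ.filter fun e => dst e = k).image (fun e => Sum.inl (src e)) := by
      intro y hy
      rw [SimpleGraph.mem_neighborFinset] at hy
      cases y with
      | inr k' => exact absurd hy (bipGraph_not_adj_inr_inr _ _ _)
      | inl i =>
        obtain ⟨e, he1, he2⟩ := (bipGraph_adj_inr_inl _ _ _).1 hy
        exact Finset.mem_image.2 ⟨e, by simp [he2], by rw [he1]⟩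
    exact (Finset.card_le_card hsub).trans (Finset.card_image_le.trans (hdeg₂ k))

/-- The two ways of writing the vertex set of a pair agree. -/
theorem coe_disjSum_eq_setOf {α β : Type*} (W₁ : Finset α) (W₂ : Finset β) :
    ((W₁.disjSum W₂ : Finset (α ⊕ β)) : Set (α ⊕ β))
      = {x | Sum.elim (fun i => i ∈ W₁) (fun j => j ∈ W₂) x} := by
  ext x; cases x with
  | inl i => simp
  | inr j => simp

/-- COUNTING CONNECTED PAIRS INSIDE THE SPOT by size, anchored at the spot's vertices: a family `𝒲k` of
pairs `(W₁, W₂) ⊆ (V₁, V₂)`, connected for the spot's leg relation and of total size `k`, has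
`#𝒲k ≤ (|V₁|+|V₂|)·Lₙ^{2(k-1)}` (prover-1's `card_connectedPairs_through_le` summed over anchors). -/
theorem card_spotPairs_le {α β E : Type} [Fintype α] [Fintype β] [DecidableEq α] [DecidableEq β]
    [Fintype E] (src : E → α) (dst : E → β) (V₁ : Finset α) (V₂ : Finset β) {Lₙ : ℕ}
    (hdeg₁ : ∀ i, (Finset.univ.filter fun e => src e = i).card ≤ Lₙ)
    (hdeg₂ : ∀ k, (Finset.univ.filter fun e => dst e = k).card ≤ Lₙ)
    (k : ℕ) (𝒲k : Finset (Finset α × Finset β))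
    (h𝒲k : ∀ W ∈ 𝒲k, W.1 ⊆ V₁ ∧ W.2 ⊆ V₂ ∧
      IsConnectedPair (fun i k => ∃ e, src e = i ∧ dst e = k) W.1 W.2 ∧ W.1.card + W.2.card = k) :
    (𝒲k.card : ℝ) ≤ ((V₁.card : ℝ) + V₂.card) * (Lₙ : ℝ) ^ (2 * (k - 1)) := by
  classical
  -- every pair of `𝒲k` has an anchor in `V₁ ⊕ V₂`
  have hcover : 𝒲k ⊆ (V₁.disjSum V₂).biUnion (fun x => 𝒲k.filter fun W => x ∈ W.1.disjSum W.2) := by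
    intro W hW
    obtain ⟨h1, h2, hc, _⟩ := h𝒲k W hW
    obtain ⟨x, hx⟩ := hc.nonempty
    refine Finset.mem_biUnion.2 ⟨x, ?_, Finset.mem_filter.2 ⟨hW, hx⟩⟩
    rw [Finset.mem_disjSum] at hx ⊢
    rcases hx with ⟨a, ha, rfl⟩ | ⟨b, hb, rfl⟩
    · exact Or.inl ⟨a, h1 ha, rfl⟩
    · exact Or.inr ⟨b, h2 hb, rfl⟩
  haveI : DecidableRel (bipGraph (fun i k => ∃ e, src e = i ∧ dst e = k)).Adj := Classical.decRel _
  have hdeg : ∀ x, (bipGraph (fun i k => ∃ e, src e = i ∧ dst e = k)).degree x ≤ Lₙ :=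
    fun x => degree_bipGraph_le src dst hdeg₁ hdeg₂ x
  -- each anchored class is small
  have hanch : ∀ x, ((𝒲k.filter fun W => x ∈ W.1.disjSum W.2).card) ≤ Lₙ ^ (2 * (k - 1)) := by
    intro x
    rcases Nat.eq_zero_or_pos k with hk0 | hkpos
    · -- size 0: no connected pair
      have : (𝒲k.filter fun W => x ∈ W.1.disjSum W.2) = ∅ := by
        rw [Finset.filter_eq_empty_iff]
        intro W hW _
        obtain ⟨_, _, hc, hcard⟩ := h𝒲k W hW
        have hne := hc.nonempty
        rw [← Finset.card_pos, Finset.card_disjSum, hcard, hk0] at hne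
        exact absurd hne (lt_irrefl 0)
      rw [this, Finset.card_empty]; exact Nat.zero_le _
    · obtain ⟨n, rfl⟩ : ∃ n, k = n + 1 := ⟨k - 1, by omega⟩
      have hinj : ((𝒲k.filter fun W => x ∈ W.1.disjSum W.2).card)
          ≤ Nat.card {W : Finset α × Finset β //
              x ∈ W.1.disjSum W.2 ∧ W.1.card + W.2.card = n + 1 ∧
              IsConnectedPair (fun i k => ∃ e, src e = i ∧ dst e = k) W.1 W.2} := by
        rw [← Fintype.card_coe, ← Nat.card_eq_fintype_card]
        refine Nat.card_le_card_of_injective (fun W => ⟨W.1, ?_⟩) ?_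
        · have hW := Finset.mem_filter.1 W.2
          obtain ⟨_, _, hc, hcard⟩ := h𝒲k _ hW.1
          exact ⟨hW.2, hcard, hc⟩
        · intro a b hab
          simp only [Subtype.mk.injEq] at hab
          exact Subtype.ext hab
      simpa using hinj.trans (card_connectedPairs_through_le _ hdeg x n)
  calc (𝒲k.card : ℝ)
      ≤ (((V₁.disjSum V₂).biUnion (fun x => 𝒲k.filter fun W => x ∈ W.1.disjSum W.2)).card : ℝ) := by
        exact_mod_cast Finset.card_le_card hcover
    _ ≤ ((∑ x ∈ V₁.disjSum V₂, (𝒲k.filter fun W => x ∈ W.1.disjSum W.2).card : ℕ) : ℝ) := by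
        exact_mod_cast Finset.card_biUnion_le
    _ ≤ ((∑ _x ∈ V₁.disjSum V₂, Lₙ ^ (2 * (k - 1)) : ℕ) : ℝ) := by
        exact_mod_cast Finset.sum_le_sum fun x _ => hanch x
    _ = ((V₁.card : ℝ) + V₂.card) * (Lₙ : ℝ) ^ (2 * (k - 1)) := by
        rw [Finset.sum_const, Finset.card_disjSum, smul_eq_mul]; push_cast; ring

/-- NUMERICS OF THE `ê`-SUM over a counted family: if the pairs of `𝒲` of total size `k` number at most
`Vc·Lₙ^{2(k-1)}` and `γ² ≥ 144·Lₙ·ln Lₙ` (`Lₙ ≥ 2`), then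
`Σ_{W∈𝒲} Lₙ(|W₁|+|W₂|)·e^{−γ²(|W₁|+|W₂|)/(12Lₙ)} ≤ Vc·Lₙ·2·Lₙ⁻¹¹`. -/
theorem hatE_weight_sum_le {α β : Type} [Fintype α] [Fintype β] (𝒲 : Finset (Finset α × Finset β))
    {Vc : ℝ} (hVc : 0 ≤ Vc) {Lₙ : ℕ} (hLₙ2 : 2 ≤ (Lₙ : ℝ)) {γ : ℝ}
    (hγL : 144 * (Lₙ : ℝ) * Real.log Lₙ ≤ γ ^ 2)
    (hcount : ∀ k, ((𝒲.filter fun W => W.1.card + W.2.card = k).card : ℝ)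
      ≤ Vc * (Lₙ : ℝ) ^ (2 * (k - 1))) :
    ∑ W ∈ 𝒲, ((Lₙ : ℝ) * ((W.1.card : ℝ) + W.2.card))
        * Real.exp (-(γ ^ 2 * ((W.1.card : ℝ) + W.2.card) / (12 * Lₙ)))
      ≤ Vc * ((Lₙ : ℝ) * (2 * ((Lₙ : ℝ) ^ 11)⁻¹)) := by
  have hLₙ0 : (0 : ℝ) ≤ Lₙ := by linarith
  -- the weight only depends on the size
  have h1 : ∑ W ∈ 𝒲, ((Lₙ : ℝ) * ((W.1.card : ℝ) + W.2.card))
        * Real.exp (-(γ ^ 2 * ((W.1.card : ℝ) + W.2.card) / (12 * Lₙ)))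
      = ∑ W ∈ 𝒲, (fun k : ℕ => (Lₙ : ℝ) * ((k : ℝ) * Real.exp (-(γ ^ 2 * k / (12 * Lₙ)))))
          (W.1.card + W.2.card) := by
    refine Finset.sum_congr rfl fun W _ => ?_
    push_cast; ring
  rw [h1]
  have h2 := sum_le_sum_by_size 𝒲
    (fun k : ℕ => (Lₙ : ℝ) * ((k : ℝ) * Real.exp (-(γ ^ 2 * k / (12 * Lₙ)))))
    (fun k => by positivity) (fun k => Vc * (Lₙ : ℝ) ^ (2 * (k - 1))) hcount
  refine h2.trans ?_
  have h3 := hatWeight_range_le hLₙ2 (le_refl (Lₙ : ℝ)) hγL (Fintype.card α + Fintype.card β)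
  have e1 : ∑ k ∈ Finset.range (Fintype.card α + Fintype.card β + 1),
      Vc * (Lₙ : ℝ) ^ (2 * (k - 1)) * ((Lₙ : ℝ) * ((k : ℝ) * Real.exp (-(γ ^ 2 * k / (12 * Lₙ)))))
      = Vc * ((Lₙ : ℝ) * ∑ k ∈ Finset.range (Fintype.card α + Fintype.card β + 1),
          (Lₙ : ℝ) ^ (2 * (k - 1)) * ((k : ℝ) * Real.exp (-(γ ^ 2 * k / (12 * Lₙ))))) := by
    rw [Finset.mul_sum, Finset.mul_sum]
    exact Finset.sum_congr rfl fun k _ => by ring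
  rw [e1]
  exact mul_le_mul_of_nonneg_left (mul_le_mul_of_nonneg_left h3 hLₙ0) hVc

/-- **THE SPOT PACKAGE.**  See the module docstring. -/
theorem spot_package {α β E : Type} [Fintype α] [Fintype β] [DecidableEq α] [DecidableEq β]
    [Fintype E] {m : ℕ} (src : E → α) (dst : E → β) (out : E → Fin m)
    (V₁ : Finset α) (V₂ : Finset β) (hE : ∀ e, src e ∈ V₁ ∧ dst e ∈ V₂)
    (hout : ∀ j : Fin m, (Finset.univ.filter fun e => out e = j).card ≤ 3)
    {Lₙ : ℕ} (hLₙ : 0 < Lₙ) (hdeg₁ : ∀ i, (Finset.univ.filter fun e => src e = i).card ≤ Lₙ)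
    (hdeg₂ : ∀ k, (Finset.univ.filter fun e => dst e = k).card ≤ Lₙ)
    (hLₙ2 : 2 ≤ (Lₙ : ℝ)) {γ' : ℝ} (hγ' : 0 ≤ γ') (hγ'L : 144 * (Lₙ : ℝ) * Real.log Lₙ ≤ γ' ^ 2)
    (hdense : 60 * γ' * Real.sqrt ((V₁.card : ℝ) * (V₂.card : ℝ)) < Fintype.card E)
    (M : (Fin m → Bool) → Matrix α β ℝ)
    (hM : ∀ T i k, M T i k = ∑ e ∈ Finset.univ.filter (fun e => src e = i ∧ dst e = k),
      ((boolSign (T (out e)) : ℤ) : ℝ)) :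
    ∃ hatS : (Fin m → Bool) → ℝ, (∀ T, 0 ≤ hatS T) ∧
      (∑ T, hatS T ≤ 2 ^ m * (4 * ((V₁.card : ℝ) + V₂.card) * ((Lₙ : ℝ) ^ 10)⁻¹)) ∧
      (∀ (T : Fin m → Bool) (σ : α → ℝ) (φ : β → ℝ), (∀ i, σ i = 1 ∨ σ i = -1) →
        (∀ k, φ k = 1 ∨ φ k = -1) → σ ⬝ᵥ (M T *ᵥ φ) < (Fintype.card E : ℝ) / 30 + hatS T) := by
  classical
  -- the spot graph and the families of (bad) connected pairs inside the spot
  obtain ⟨Es, hEs⟩ : ∃ Es : α → β → Prop, Es = fun i k => ∃ e, src e = i ∧ dst e = k := ⟨_, rfl⟩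
  have hG : ∀ e, (bipGraph Es).Adj (Sum.inl (src e)) (Sum.inr (dst e)) := fun e =>
    (bipGraph_adj_inl_inr Es _ _).2 (by rw [hEs]; exact ⟨e, rfl, rfl⟩)
  obtain ⟨𝒲, h𝒲⟩ : ∃ 𝒲 : Finset (Finset α × Finset β), 𝒲 = Finset.univ.filter fun W =>
      W.1 ⊆ V₁ ∧ W.2 ⊆ V₂ ∧ IsConnectedPair Es W.1 W.2 := ⟨_, rfl⟩
  obtain ⟨bad, hbadDef⟩ : ∃ bad : (Fin m → Bool) → Finset (Finset α × Finset β), bad = fun T =>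
      𝒲.filter fun W =>
        γ' * Real.sqrt ((W.1.card : ℝ) * (W.2.card : ℝ)) < |∑ i ∈ W.1, ∑ k ∈ W.2, M T i k| :=
    ⟨_, rfl⟩
  refine ⟨fun T => ∑ W ∈ bad T, ((Finset.univ.filter fun e => src e ∈ W.1 ∨ dst e ∈ W.2).card : ℝ),
    fun T => Finset.sum_nonneg fun W _ => Nat.cast_nonneg _, ?_, ?_⟩
  · ----------------------------------------------------------------
    -- Lemma 10 + counting + numerics
    ----------------------------------------------------------------
    have hsub : ∀ T, bad T ⊆ 𝒲 := fun T => by rw [hbadDef]; exact Finset.filter_subset _ _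
    have hbad : ∀ T W, W ∈ bad T →
        γ' * Real.sqrt ((W.1.card : ℝ) * (W.2.card : ℝ)) < |∑ i ∈ W.1, ∑ k ∈ W.2, M T i k| := by
      intro T W hW; rw [hbadDef] at hW; exact (Finset.mem_filter.1 hW).2
    have h1 := sum_hatE_le src dst out M hM hout hLₙ hdeg₁ hdeg₂ hγ' bad 𝒲 hsub hbad
    -- meet(W) ≤ Lₙ·|W|
    have h2 : ∑ W ∈ 𝒲, ((Finset.univ.filter fun e => src e ∈ W.1 ∨ dst e ∈ W.2).card : ℝ)
          * Real.exp (-(γ' ^ 2 * ((W.1.card : ℝ) + W.2.card) / (12 * Lₙ)))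
        ≤ ∑ W ∈ 𝒲, ((Lₙ : ℝ) * ((W.1.card : ℝ) + W.2.card))
          * Real.exp (-(γ' ^ 2 * ((W.1.card : ℝ) + W.2.card) / (12 * Lₙ))) := by
      refine Finset.sum_le_sum fun W _ => mul_le_mul_of_nonneg_right ?_ (Real.exp_pos _).le
      exact_mod_cast card_meeting_le src dst hdeg₁ hdeg₂ W.1 W.2
    -- counting + numerics
    have hV0 : (0 : ℝ) ≤ (V₁.card : ℝ) + V₂.card := by positivity
    have hcount : ∀ k, ((𝒲.filter fun W => W.1.card + W.2.card = k).card : ℝ)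
        ≤ ((V₁.card : ℝ) + V₂.card) * (Lₙ : ℝ) ^ (2 * (k - 1)) := by
      intro k
      refine card_spotPairs_le src dst V₁ V₂ hdeg₁ hdeg₂ k _ fun W hW => ?_
      rw [h𝒲, Finset.mem_filter, Finset.mem_filter] at hW
      rw [hEs] at hW
      exact ⟨hW.1.2.1, hW.1.2.2.1, hW.1.2.2.2, hW.2⟩
    have h3 := hatE_weight_sum_le 𝒲 hV0 hLₙ2 hγ'L hcount
    have hLₙ0 : (0 : ℝ) < Lₙ := by exact_mod_cast hLₙ
    calc ∑ T, ∑ W ∈ bad T, ((Finset.univ.filter fun e => src e ∈ W.1 ∨ dst e ∈ W.2).card : ℝ)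
        ≤ 2 * 2 ^ m * ∑ W ∈ 𝒲, ((Finset.univ.filter fun e => src e ∈ W.1 ∨ dst e ∈ W.2).card : ℝ)
            * Real.exp (-(γ' ^ 2 * ((W.1.card : ℝ) + W.2.card) / (12 * Lₙ))) := h1
      _ ≤ 2 * 2 ^ m * (((V₁.card : ℝ) + V₂.card) * ((Lₙ : ℝ) * (2 * ((Lₙ : ℝ) ^ 11)⁻¹))) :=
          mul_le_mul_of_nonneg_left (h2.trans h3) (by positivity)
      _ = 2 ^ m * (4 * ((V₁.card : ℝ) + V₂.card) * ((Lₙ : ℝ) * ((Lₙ : ℝ) ^ 11)⁻¹)) := by ring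
      _ = 2 ^ m * (4 * ((V₁.card : ℝ) + V₂.card) * ((Lₙ : ℝ) ^ 10)⁻¹) := by
          have : (Lₙ : ℝ) * ((Lₙ : ℝ) ^ 11)⁻¹ = ((Lₙ : ℝ) ^ 10)⁻¹ := by
            field_simp
          rw [this]
  · ----------------------------------------------------------------
    -- Prop. 9 with `B = ⋃ bad`
    ----------------------------------------------------------------
    intro T σ φ hσ hφ
    have hs : ∀ e : E, |((boolSign (T (out e)) : ℤ) : ℝ)| ≤ 1 := fun e => by
      rcases boolSign_eq_one_or (T (out e)) with h | h <;> simp [h]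
    -- Prop. 9 with `B₁ = ⋃ W₁`, `B₂ = ⋃ W₂` over `bad T`, then `e_B ≤ ê` (as in `SfmBlAssembly.spot_cut_lt_hatE`,
    -- re-derived here from `spot_cut_lt_of_dense` + `good_of_disjoint_bad` + `card_meeting_bad_le_hatE`)
    suffices hbadT : ∀ (W₁ : Finset α) (W₂ : Finset β),
        ((bipGraph Es).induce {x | Sum.elim (fun i => i ∈ W₁) (fun j => j ∈ W₂) x}).Connected →
        γ' * Real.sqrt ((W₁.card : ℝ) * (W₂.card : ℝ)) < |∑ i ∈ W₁, ∑ k ∈ W₂, M T i k| →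
        (W₁, W₂) ∈ bad T by
      have h1 := spot_cut_lt_of_dense src dst V₁ V₂ hE (fun e => ((boolSign (T (out e)) : ℤ) : ℝ)) hs
        (M T) (hM T) (bipGraph Es) hG hγ' ((bad T).biUnion Prod.fst) ((bad T).biUnion Prod.snd)
        (fun W₁ W₂ hd₁ hd₂ hconn => good_of_disjoint_bad (bipGraph Es) (M T) (bad T) hbadT W₁ W₂ hd₁ hd₂ hconn)
        hdense σ φ hσ hφ
      have h2 : ((Finset.univ.filter fun e =>
            src e ∈ (bad T).biUnion Prod.fst ∨ dst e ∈ (bad T).biUnion Prod.snd).card : ℝ)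
          ≤ ∑ W ∈ bad T, ((Finset.univ.filter fun e => src e ∈ W.1 ∨ dst e ∈ W.2).card : ℝ) := by
        exact_mod_cast card_meeting_bad_le_hatE src dst (bad T)
      linarith
    intro W₁ W₂ hconn hdisc
    -- both sides are nonempty (the discrepancy is nonzero)
    have hne₁ : W₁.Nonempty := by
      rw [Finset.nonempty_iff_ne_empty]; rintro rfl
      simp only [Finset.sum_empty, abs_zero, Finset.card_empty, Nat.cast_zero, zero_mul,
        Real.sqrt_zero, mul_zero, lt_self_iff_false] at hdisc
    have hne₂ : W₂.Nonempty := by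
      rw [Finset.nonempty_iff_ne_empty]; rintro rfl
      simp only [Finset.sum_empty, Finset.sum_const_zero, abs_zero, Finset.card_empty, Nat.cast_zero,
        mul_zero, Real.sqrt_zero, lt_self_iff_false] at hdisc
    obtain ⟨i₀, hi₀⟩ := hne₁
    obtain ⟨k₀, hk₀⟩ := hne₂
    -- every vertex of the pair has a neighbour, hence lies in `V₁ ⊕ V₂`
    have hX : ∀ x, x ∈ ({x | Sum.elim (fun i => i ∈ W₁) (fun j => j ∈ W₂) x} : Set (α ⊕ β)) →
        Sum.elim (fun i => i ∈ V₁) (fun j => j ∈ V₂) x := by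
      intro x hx
      obtain ⟨y, hy, hxy⟩ : ∃ y, y ∈ ({x | Sum.elim (fun i => i ∈ W₁) (fun j => j ∈ W₂) x} :
          Set (α ⊕ β)) ∧ x ≠ y := by
        by_cases h : x = Sum.inl i₀
        · exact ⟨Sum.inr k₀, by simpa using hk₀, by rw [h]; exact Sum.inl_ne_inr⟩
        · exact ⟨Sum.inl i₀, by simpa using hi₀, h⟩
      obtain ⟨z, _, hxz⟩ := exists_adj_of_connected_induce (bipGraph Es) _ hconn hx hy hxy
      cases x with
      | inl i =>
        cases z with
        | inl i' => exact absurd hxz (bipGraph_not_adj_inl_inl _ _ _)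
        | inr k =>
          have h' := (bipGraph_adj_inl_inr Es _ _).1 hxz
          rw [hEs] at h'
          obtain ⟨e, he1, _⟩ := h'
          simp only [Sum.elim_inl]; rw [← he1]; exact (hE e).1
      | inr k =>
        cases z with
        | inr k' => exact absurd hxz (bipGraph_not_adj_inr_inr _ _ _)
        | inl i =>
          have h' := (bipGraph_adj_inr_inl Es _ _).1 hxz
          rw [hEs] at h'
          obtain ⟨e, _, he2⟩ := h'
          simp only [Sum.elim_inr]; rw [← he2]; exact (hE e).2
    have hW₁ : W₁ ⊆ V₁ := fun i hi => by simpa using hX (Sum.inl i) (by simpa using hi)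
    have hW₂ : W₂ ⊆ V₂ := fun k hk => by simpa using hX (Sum.inr k) (by simpa using hk)
    have hconn' : IsConnectedPair Es W₁ W₂ := by
      unfold IsConnectedPair
      rw [coe_disjSum_eq_setOf]; exact hconn
    rw [hbadDef, Finset.mem_filter, h𝒲, Finset.mem_filter]
    exact ⟨⟨Finset.mem_univ _, hW₁, hW₂, hconn'⟩, hdisc⟩

end Summit.PneNP.PneNP.Theorems.SfmBl
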